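import Literature.NumberTheory.LFunctions.DobnerNewman
import Literature.Analysis.SpecialFunctions.GammaStirlingUniform
import Literature.Analysis.SpecialFunctions.GammaStirlingVertical
import Literature.Analysis.SpecialFunctions.GammaVerticalBounds
import Mathlib.Analysis.SpecialFunctions.Trigonometric.Bounds

/-!
# RiemannHypothesis / UniversalFactor — `NarrowKernelNoGo` (stmt-RiemannHypothesis-2576), line `Sketch`:
# stub P2, the ξ-envelope on the critical line — vertical Stirling and the global bound

With `γ = xiGammaFactor` (`γ(s) = ½ s(s − 1) Γ_ℝ(s)`, `Γ_ℝ(s) = π^{-s/2} Γ(s/2)`) the envelope of `ξ`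
on the critical line is

  `E(τ) := ‖γ(1/2 + iτ)‖ = ((τ² + 1/4)/2) · π^{-1/4} · ‖Γ(1/4 + iτ/2)‖`

(`UniversalFactor.narrowEnvelope_norm_eq`). This is the first of two files proving the stub
`UniversalFactor.stub_narrowEnvelope` of the line (the second is
`UniversalFactorNarrowKernelNoGoEnvelope.lean`). Here:

* `UniversalFactor.narrowEnvelope_stirling` — **Stirling on vertical lines with an `O(1/|u|)`
  remainder**: for `x > 0`, `|u| ≥ 1`,
  `|log ‖Γ(x+iu)‖ − ((x − ½) log|u| − π|u|/2 + ½ log 2π)| ≤ ((x + ½)x² + ¼)/|u|`.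
  The input is the tree's uniform Stirling formula for `log ‖Γ(w)‖` on `Re w > 0`
  (`GammaStirling.abs_log_norm_Gamma_sub_le`); the tree's vertical corollary
  `GammaStirling.abs_log_norm_Gamma_vertical_sub_le_of_pos` has an `O(1)` remainder only, which is
  not enough for the asymptotics of the envelope against the weight `t^{-7/4} e^{πt/4}`. The two
  elementary refinements are `0 ≤ log ‖w‖ − log|u| ≤ x²/(2u²)` and
  `x − x³/(2|u|) ≤ |u| arcsin(x/‖w‖) ≤ x` (`sin θ ≤ θ ≤ tan θ`), `w = x + iu`
  (`UniversalFactor.narrowEnvelope_rem_le`, `UniversalFactor.narrowEnvelope_arcsin_mem`).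
* `UniversalFactor.narrowEnvelope_global` — part (i) of the stub: the global bound
  `E(τ) ≤ C₀ (1 + |τ|)^{7/4} e^{−π|τ|/4}` for all real `τ` (Stirling for `|τ| ≥ 2`,
  `‖Γ(1/4 + iy)‖ ≤ Γ(1/4)` for `|τ| ≤ 2`).

References: E. C. Titchmarsh, *The Theory of the Riemann Zeta-Function* (1986), §4.12 (4.12.2),
§7.2–7.4; Whittaker–Watson §12.33, §13.6.
-/

noncomputable section

-- D-0017: `Summit.<S>.<S>.…` is the designed namespace of a single-problem summit.
set_option linter.dupNamespace false

namespace Summit.RiemannHypothesis.RiemannHypothesis.Theorems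

open MeasureTheory Set Filter Complex intervalIntegral
open scoped Real Topology
open Literature.NumberTheory.LFunctions
open Literature.Analysis.SpecialFunctions

/-! ## The envelope in terms of `Γ(1/4 + iτ/2)` -/

/-- On the critical line, `‖γ(1/2 + iτ)‖ = ((τ² + 1/4)/2) · π^{-1/4} · ‖Γ(1/4 + iτ/2)‖`
(`s(s − 1) = −(τ² + 1/4)` at `s = 1/2 + iτ`, `‖π^{-s/2}‖ = π^{-1/4}`). [folklore] -/
theorem UniversalFactor.narrowEnvelope_norm_eq (τ : ℝ) :
    ‖xiGammaFactor (1 / 2 + (τ : ℂ) * I)‖ =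
      (τ ^ 2 + 1 / 4) / 2 * π ^ (-(1 / 4 : ℝ)) *
        ‖Complex.Gamma (((1 / 4 : ℝ) : ℂ) + ((τ / 2 : ℝ) : ℂ) * I)‖ := by
  rw [xiGammaFactor, Complex.Gammaℝ_def, norm_mul, norm_mul]
  have h1 : ‖(1 / 2 + (τ : ℂ) * I) * (1 / 2 + (τ : ℂ) * I - 1) / 2‖ = (τ ^ 2 + 1 / 4) / 2 := by
    have : (1 / 2 + (τ : ℂ) * I) * (1 / 2 + (τ : ℂ) * I - 1) / 2 =
        ((-((τ ^ 2 + 1 / 4) / 2) : ℝ) : ℂ) := by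
      push_cast
      linear_combination ((τ : ℂ) ^ 2 / 2) * Complex.I_sq
    rw [this, Complex.norm_real, Real.norm_eq_abs, abs_neg, abs_of_pos (by positivity)]
  have h2 : ‖(π : ℂ) ^ (-(1 / 2 + (τ : ℂ) * I) / 2)‖ = π ^ (-(1 / 4 : ℝ)) := by
    rw [Complex.norm_cpow_eq_rpow_re_of_pos Real.pi_pos]
    congr 1
    simp
    norm_num
  have h3 : Complex.Gamma ((1 / 2 + (τ : ℂ) * I) / 2) =
      Complex.Gamma (((1 / 4 : ℝ) : ℂ) + ((τ / 2 : ℝ) : ℂ) * I) := by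
    congr 1
    push_cast
    ring
  rw [h1, h2, h3]
  ring

/-! ## Vertical Stirling with an `O(1/|u|)` remainder -/

/-- The remainder of the uniform Stirling formula on a vertical line: for `1 ≤ a ≤ n`,
`(1/12)(1/n² + π/(2n)) ≤ (1/4)/a` (used with `n = ‖x + iu‖`, `a = |u|`). [folklore] -/
theorem UniversalFactor.narrowEnvelope_rem_le {n a : ℝ} (ha : 1 ≤ a) (han : a ≤ n) :
    (1 / 12 : ℝ) * (1 / n ^ 2 + π / (2 * n)) ≤ (1 / 4) / a := by
  have ha0 : 0 < a := by linarith
  have hn0 : 0 < n := by linarith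
  have h1 : 1 / n ^ 2 ≤ 1 / a := div_le_div_of_nonneg_left zero_le_one ha0 (by nlinarith)
  have h2 : π / (2 * n) ≤ 2 / a := by
    rw [div_le_div_iff₀ (by positivity) ha0]
    nlinarith [Real.pi_lt_four, Real.pi_pos]
  calc (1 / 12 : ℝ) * (1 / n ^ 2 + π / (2 * n)) ≤ (1 / 12) * (1 / a + 2 / a) :=
        mul_le_mul_of_nonneg_left (add_le_add h1 h2) (by norm_num)
    _ = (1 / 4) / a := by ring

/-- `x − x³/(2a) ≤ a · arcsin(x/n) ≤ x` for `x > 0`, `1 ≤ a ≤ n`, `n² = x² + a²`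
(`sin θ ≤ θ ≤ tan θ` at `θ = arcsin(x/n)`, `tan θ = x/a`, and `n − a = x²/(n + a) ≤ x²/(2a)`;
used with `n = ‖x + iu‖`, `a = |u|`, where `u · arg(x + iu) = |u|(π/2 − arcsin(x/n))`). [folklore] -/
theorem UniversalFactor.narrowEnvelope_arcsin_mem {x n a : ℝ} (hx : 0 < x) (ha : 1 ≤ a)
    (han : a ≤ n) (hsq : n ^ 2 = x ^ 2 + a ^ 2) :
    x - x ^ 3 / (2 * a) ≤ a * Real.arcsin (x / n) ∧ a * Real.arcsin (x / n) ≤ x := by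
  have ha0 : 0 < a := by linarith
  have hn0 : 0 < n := by linarith
  have hn1 : 1 ≤ n := ha.trans han
  have hxn : x < n := by nlinarith
  have hz0 : 0 ≤ x / n := by positivity
  have hz1 : x / n < 1 := by rwa [div_lt_one hn0]
  have ha0' : 0 ≤ Real.arcsin (x / n) := Real.arcsin_nonneg.mpr hz0
  constructor
  · -- lower bound: `sin θ ≤ θ`
    have h1 : x / n ≤ Real.arcsin (x / n) := by
      have := Real.sin_le ha0'
      rwa [Real.sin_arcsin (by linarith) hz1.le] at this
    have h2 : a * (x / n) ≤ a * Real.arcsin (x / n) := mul_le_mul_of_nonneg_left h1 ha0.le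
    have hna : n - a ≤ x ^ 2 / (2 * a) := by
      rw [le_div_iff₀ (by positivity)]
      nlinarith [sq_nonneg (n - a)]
    have h5 : x * (n - a) ≤ x ^ 3 / (2 * a) := by
      calc x * (n - a) ≤ x * (x ^ 2 / (2 * a)) := mul_le_mul_of_nonneg_left hna hx.le
        _ = x ^ 3 / (2 * a) := by ring
    have h6 : x ^ 3 / (2 * a) ≤ x ^ 3 / (2 * a) * n :=
      le_mul_of_one_le_right (by positivity) hn1
    have h7 : x - x ^ 3 / (2 * a) ≤ a * (x / n) := by
      rw [← mul_div_assoc, le_div_iff₀ hn0]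
      nlinarith
    exact h7.trans h2
  · -- upper bound: `θ ≤ tan θ = x/a`
    have hsqrt : Real.sqrt (1 - (x / n) ^ 2) = a / n := by
      have : 1 - (x / n) ^ 2 = (a / n) ^ 2 := by
        rw [div_pow, div_pow]
        field_simp
        linarith
      rw [this, Real.sqrt_sq (by positivity)]
    have ha1 : Real.arcsin (x / n) < π / 2 := Real.arcsin_lt_pi_div_two.mpr hz1
    have ht := Real.le_tan ha0' ha1
    rw [Real.tan_arcsin, hsqrt, div_div_div_cancel_right₀ hn0.ne'] at ht
    calc a * Real.arcsin (x / n) ≤ a * (x / a) := mul_le_mul_of_nonneg_left ht ha0.le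
      _ = x := by rw [← mul_div_assoc, mul_div_cancel_left₀ x ha0.ne']

/-- **Stirling on vertical lines with an `O(1/|u|)` remainder.** For `x > 0` and `|u| ≥ 1`,
`|log ‖Γ(x + iu)‖ − ((x − 1/2) log |u| − π|u|/2 + ½ log 2π)| ≤ ((x + ½) x² + ¼)/|u|`
(from the uniform Stirling formula `GammaStirling.abs_log_norm_Gamma_sub_le` with
`0 ≤ log ‖w‖ − log |u| ≤ x²/(2u²)` and `x − x³/(2|u|) ≤ π|u|/2 − u · arg w ≤ x`;
Titchmarsh (4.12.2)). [folklore] -/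
theorem UniversalFactor.narrowEnvelope_stirling {x u : ℝ} (hx : 0 < x) (hu : 1 ≤ |u|) :
    |Real.log ‖Complex.Gamma ((x : ℂ) + u * I)‖ -
        ((x - 1 / 2) * Real.log |u| - π * |u| / 2 + Real.log (2 * π) / 2)| ≤
      ((x + 1 / 2) * x ^ 2 + 1 / 4) / |u| := by
  have hu0 : u ≠ 0 := by intro h; rw [h, abs_zero] at hu; linarith
  have hu1 : 0 < |u| := by linarith
  -- the tree's inputs, all about `w = x + iu`
  obtain ⟨hE1l, hE1u⟩ := GammaStirling.log_norm_sub_log_abs_mem (x := x) hu0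
  have harg := GammaStirling.im_mul_arg_eq (u := u) hx
  have hwu : |u| ≤ ‖(x : ℂ) + u * I‖ := GammaStirling.abs_le_norm_ofReal_add_mul_I x u
  have hsq : ‖(x : ℂ) + u * I‖ ^ 2 = x ^ 2 + |u| ^ 2 := by
    rw [sq_abs]; exact GammaRatio.norm_sq_eq x u
  have hS := GammaStirling.abs_log_norm_Gamma_sub_le (w := (x : ℂ) + u * I) (by simpa using hx)
  have hre : ((x : ℂ) + u * I).re = x := by simp
  have him : ((x : ℂ) + u * I).im = u := by simp
  rw [hre, him, harg] at hS
  -- opaque names for `‖w‖` and `log ‖Γ(w)‖`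
  generalize hn : ‖(x : ℂ) + u * I‖ = n at hE1l hE1u hwu hsq hS
  generalize hL : Real.log ‖Complex.Gamma ((x : ℂ) + u * I)‖ = L at hS ⊢
  -- the three error terms
  have h1 := hS.trans (UniversalFactor.narrowEnvelope_rem_le hu hwu)
  obtain ⟨h3l, h3u⟩ := UniversalFactor.narrowEnvelope_arcsin_mem hx hu hwu hsq
  have hE1u' : Real.log n - Real.log |u| ≤ x ^ 2 / (2 * |u|) := by
    refine hE1u.trans (div_le_div_of_nonneg_left (sq_nonneg x) (by positivity) ?_)
    nlinarith [sq_abs u]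
  have h2 : |(x - 1 / 2) * (Real.log n - Real.log |u|)| ≤ (x + 1 / 2) * (x ^ 2 / (2 * |u|)) := by
    rw [abs_mul, abs_of_nonneg hE1l]
    have : |x - 1 / 2| ≤ x + 1 / 2 := abs_sub_le_iff.mpr ⟨by linarith, by linarith⟩
    exact mul_le_mul this hE1u' hE1l (by linarith)
  -- bookkeeping
  have hsplit : L - ((x - 1 / 2) * Real.log |u| - π * |u| / 2 + Real.log (2 * π) / 2) =
      (L - ((x - 1 / 2) * Real.log n - |u| * (π / 2 - Real.arcsin (x / n)) - x +
        Real.log (2 * π) / 2)) +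
      (x - 1 / 2) * (Real.log n - Real.log |u|) + (|u| * Real.arcsin (x / n) - x) := by
    ring
  have hB : ((x + 1 / 2) * x ^ 2 + 1 / 4) / |u| =
      (1 / 4) / |u| + x ^ 3 / |u| + (1 / 2) * (x ^ 2 / |u|) := by
    field_simp
    ring
  have hx2 : 0 ≤ x ^ 2 / |u| := by positivity
  have hx3 : 0 ≤ x ^ 3 / |u| := by positivity
  have e2 : (x + 1 / 2) * (x ^ 2 / (2 * |u|)) = (1 / 2) * (x ^ 3 / |u|) + (1 / 4) * (x ^ 2 / |u|) := by
    field_simp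
    ring
  have e3 : x ^ 3 / (2 * |u|) = (1 / 2) * (x ^ 3 / |u|) := by
    field_simp
  rw [e2] at h2
  rw [e3] at h3l
  obtain ⟨h1a, h1b⟩ := abs_le.mp h1
  obtain ⟨h2a, h2b⟩ := abs_le.mp h2
  rw [hsplit, hB, abs_le]
  constructor <;> linarith

/-! ## Part (i): the global bound -/

/-- **Global bound for the envelope.** There is `C₀` with
`‖γ(1/2 + iτ)‖ ≤ C₀ (1 + |τ|)^{7/4} e^{−π|τ|/4}` for all real `τ` (Stirling for `|τ| ≥ 2`;
`‖Γ(1/4 + iy)‖ ≤ Γ(1/4)`, `GammaVert.norm_Gamma_le_Gamma_re`, for `|τ| ≤ 2`). [folklore] -/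
theorem UniversalFactor.narrowEnvelope_global :
    ∃ C₀ : ℝ, ∀ τ : ℝ, ‖Literature.NumberTheory.LFunctions.xiGammaFactor (1 / 2 + (τ : ℂ) * Complex.I)‖ ≤
      C₀ * (1 + |τ|) ^ ((7 : ℝ) / 4) * Real.exp (-(Real.pi * |τ| / 4)) := by
  obtain ⟨c₁, hc₁⟩ : ∃ c : ℝ,
      c = Real.log π * (-(1 / 4 : ℝ)) + Real.log 2 / 4 + Real.log (2 * π) / 2 + 1 := ⟨_, rfl⟩
  have hπ4 : 0 < π ^ (-(1 / 4 : ℝ)) := Real.rpow_pos_of_pos Real.pi_pos _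
  have hΓ : 0 < Real.Gamma (1 / 4) := Real.Gamma_pos_of_pos (by norm_num)
  obtain ⟨C₂, hC₂def⟩ : ∃ C : ℝ,
      C = (17 / 8) * π ^ (-(1 / 4 : ℝ)) * Real.Gamma (1 / 4) * Real.exp (π / 2) := ⟨_, rfl⟩
  have hC₂ : 0 ≤ C₂ := by
    rw [hC₂def]
    exact le_of_lt (mul_pos (mul_pos (mul_pos (by norm_num) hπ4) hΓ) (Real.exp_pos _))
  refine ⟨Real.exp c₁ + C₂, fun τ => ?_⟩
  rw [UniversalFactor.narrowEnvelope_norm_eq]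
  have hA0 : 0 < (τ ^ 2 + 1 / 4) / 2 := by positivity
  have hP : 0 ≤ (1 + |τ|) ^ ((7 : ℝ) / 4) * Real.exp (-(π * |τ| / 4)) := by positivity
  rcases le_or_gt 2 |τ| with hτ | hτ
  · -- `|τ| ≥ 2`: Stirling at `1/4 + iτ/2`
    have hτ0 : 0 < |τ| := by linarith
    have hy : 1 ≤ |τ / 2| := by rw [abs_div, abs_two]; linarith
    have hS := UniversalFactor.narrowEnvelope_stirling (x := 1 / 4) (u := τ / 2) (by norm_num) hy
    rw [abs_div, abs_two] at hS
    generalize hG : ‖Complex.Gamma (((1 / 4 : ℝ) : ℂ) + ((τ / 2 : ℝ) : ℂ) * I)‖ = G at hS ⊢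
    have hG0 : 0 < G := by
      rw [← hG]; exact norm_pos_iff.mpr (GammaVert.Gamma_ne_zero_of_pos (by norm_num) _)
    have hK : ((1 / 4 + 1 / 2) * (1 / 4 : ℝ) ^ 2 + 1 / 4) / (|τ| / 2) ≤ 1 := by
      rw [div_le_one (by positivity)]; linarith
    have hlogG : Real.log G ≤ -(1 / 4) * Real.log |τ| + Real.log 2 / 4 - π * |τ| / 4 +
        Real.log (2 * π) / 2 + 1 := by
      have h := (abs_le.mp (hS.trans hK)).2
      have hl2 : Real.log (|τ| / 2) = Real.log |τ| - Real.log 2 :=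
        Real.log_div hτ0.ne' two_ne_zero
      rw [hl2] at h
      linarith
    have hlogA : Real.log ((τ ^ 2 + 1 / 4) / 2) ≤ 2 * Real.log |τ| := by
      have h4 : (4 : ℝ) ≤ |τ| ^ 2 := by nlinarith [abs_nonneg τ]
      have hAle : (τ ^ 2 + 1 / 4) / 2 ≤ |τ| ^ 2 := by have := sq_abs τ; linarith
      calc Real.log ((τ ^ 2 + 1 / 4) / 2) ≤ Real.log (|τ| ^ 2) := Real.log_le_log hA0 hAle
        _ = 2 * Real.log |τ| := by rw [Real.log_pow]; norm_num
    have hlogτ : Real.log |τ| ≤ Real.log (1 + |τ|) := Real.log_le_log hτ0 (by linarith)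
    have hlhs : (τ ^ 2 + 1 / 4) / 2 * π ^ (-(1 / 4 : ℝ)) * G =
        Real.exp (Real.log ((τ ^ 2 + 1 / 4) / 2) + Real.log π * (-(1 / 4 : ℝ)) + Real.log G) := by
      rw [Real.exp_add, Real.exp_add, Real.exp_log hA0, Real.exp_log hG0,
        Real.rpow_def_of_pos Real.pi_pos]
    have hrhs : Real.exp c₁ * (1 + |τ|) ^ ((7 : ℝ) / 4) * Real.exp (-(π * |τ| / 4)) =
        Real.exp (c₁ + Real.log (1 + |τ|) * ((7 : ℝ) / 4) + -(π * |τ| / 4)) := by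
      rw [Real.exp_add, Real.exp_add, Real.rpow_def_of_pos (by positivity)]
    calc (τ ^ 2 + 1 / 4) / 2 * π ^ (-(1 / 4 : ℝ)) * G
        ≤ Real.exp c₁ * (1 + |τ|) ^ ((7 : ℝ) / 4) * Real.exp (-(π * |τ| / 4)) := by
          rw [hlhs, hrhs]
          exact Real.exp_le_exp.mpr (by rw [hc₁]; linarith)
      _ ≤ (Real.exp c₁ + C₂) * (1 + |τ|) ^ ((7 : ℝ) / 4) * Real.exp (-(π * |τ| / 4)) := by
          rw [mul_assoc, mul_assoc]
          exact mul_le_mul_of_nonneg_right (le_add_of_nonneg_right hC₂) hP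
  · -- `|τ| < 2`: `‖Γ(1/4 + iy)‖ ≤ Γ(1/4)`
    generalize hG : ‖Complex.Gamma (((1 / 4 : ℝ) : ℂ) + ((τ / 2 : ℝ) : ℂ) * I)‖ = G
    have hG0 : 0 < G := by
      rw [← hG]; exact norm_pos_iff.mpr (GammaVert.Gamma_ne_zero_of_pos (by norm_num) _)
    have hGle : G ≤ Real.Gamma (1 / 4) := by
      rw [← hG]; exact GammaVert.norm_Gamma_le_Gamma_re (by norm_num) _
    have hAle : (τ ^ 2 + 1 / 4) / 2 ≤ 17 / 8 := by
      have : τ ^ 2 ≤ 4 := by nlinarith [abs_nonneg τ, sq_abs τ]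
      linarith
    have h1 : (τ ^ 2 + 1 / 4) / 2 * π ^ (-(1 / 4 : ℝ)) * G ≤
        (17 / 8) * π ^ (-(1 / 4 : ℝ)) * Real.Gamma (1 / 4) :=
      mul_le_mul (mul_le_mul_of_nonneg_right hAle hπ4.le) hGle hG0.le (by positivity)
    have h2 : (17 / 8) * π ^ (-(1 / 4 : ℝ)) * Real.Gamma (1 / 4) =
        C₂ * Real.exp (-(π * 2 / 4)) := by
      rw [hC₂def, mul_assoc _ (Real.exp (π / 2)) _, ← Real.exp_add]
      have : π / 2 + -(π * 2 / 4) = 0 := by ring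
      rw [this, Real.exp_zero, mul_one]
    have h3 : Real.exp (-(π * 2 / 4)) ≤
        (1 + |τ|) ^ ((7 : ℝ) / 4) * Real.exp (-(π * |τ| / 4)) := by
      have h31 : (1 : ℝ) ≤ (1 + |τ|) ^ ((7 : ℝ) / 4) :=
        Real.one_le_rpow (by linarith [abs_nonneg τ]) (by norm_num)
      have h32 : Real.exp (-(π * 2 / 4)) ≤ Real.exp (-(π * |τ| / 4)) :=
        Real.exp_le_exp.mpr (by nlinarith [Real.pi_pos])
      calc Real.exp (-(π * 2 / 4)) = 1 * Real.exp (-(π * 2 / 4)) := (one_mul _).symm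
        _ ≤ _ := mul_le_mul h31 h32 (Real.exp_pos _).le (by positivity)
    calc (τ ^ 2 + 1 / 4) / 2 * π ^ (-(1 / 4 : ℝ)) * G ≤ C₂ * Real.exp (-(π * 2 / 4)) :=
          h1.trans_eq h2
      _ ≤ C₂ * ((1 + |τ|) ^ ((7 : ℝ) / 4) * Real.exp (-(π * |τ| / 4))) :=
          mul_le_mul_of_nonneg_left h3 hC₂
      _ ≤ (Real.exp c₁ + C₂) * ((1 + |τ|) ^ ((7 : ℝ) / 4) * Real.exp (-(π * |τ| / 4))) :=
          mul_le_mul_of_nonneg_right (le_add_of_nonneg_left (Real.exp_pos _).le) hP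
      _ = _ := by ring

end Summit.RiemannHypothesis.RiemannHypothesis.Theorems
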